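import Literature.Probability.LatticeModels.InterfaceSLELocal
import Literature.Probability.LatticeModels.InterfaceSLESource
import Literature.Probability.RandomPlanarGeometry.SpinObservableLimitPassage
import HarnessLib

/-!
# Critical Ising interfaces and SLE₃: the identification step from its two printed inputs

Topic `Literature/Probability/LatticeModels` (family `crit-ising`); theorems only. Spin-Ising
(`κ = 3`) counterpart of `FKIsingCylinderIdentityAssembly.lean` (FK-Ising, `κ = 16/3`), and
the last layer of the decomposition of the identification half F2 =
`isSLELaw_three_of_subseqLimit_spinInterface` of Chelkak–Duminil-Copin–Hongler–Kemppainen–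
Smirnov's Theorem 1 (C. R. Math. 352 (2014), §3) that can be written without vendoring a
theory. It assembles, for ONE subsequential limit law `ν` and ONE chordal uniformizing map `φ`
of the Dobrushin domain `(D; a, b)`, the whole identification argument of CDHKS §3 from the two
inputs the printed proof quotes, in the exact shapes the tree's proved reductions consume:

* **(J′) Kemppainen–Smirnov** (CDHKS Thm. 3 = Kemppainen–Smirnov 2017, Thm. 1.5 and Cor. 1.7
  with the crossing bounds of CDHKS Thm. 4 / Rem. 4): `ν`-a.e. curve class is describable by the
  Loewner evolution through `φ` (`IsLoewnerDescribable`) and starts at `a`; the capacity driving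
  processes `V^k` of the discrete interfaces (on their own probability spaces) converge in
  distribution in `C([0, ∞), ℝ)` to the driving function of the limit (`drivingFunction φ`, a
  Borel function of the curve: `DrivingFunctionMeasurable.lean`). NO tail or moment statement
  (CDHKS Thm. 3's "`sup_δ E[exp(ε|W^δ_t|/√t)] < ∞`", KS Prop. 3.8) is required — the driving
  local martingales are extracted by localisation (`SpinObservableLocalMartingale.lean`);
* **(D) Chelkak–Smirnov** (Invent. Math. 189 (2012): Rem. 2.4 — the discrete fermionic (spin)
  observable of the explored slit domain is a martingale for the exploration filtration;
  Thms 1.2 and 5.6 — it converges to its continuum counterpart uniformly over the slit domains,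
  "uniformly over all possible domains `Ω^δ_n`" in CDHKS's words): at every scale a discrete
  filtration, a complex martingale and stopping times whose stopped values approximate the
  time-limited spin observable `N^y_u(V^k)` — literally the hypothesis `hD` of the tree's PROVED
  passage theorem `Loewner.integral_spinObservableProcess_cylinder_eq_zero_of_discreteMartingales`
  (`RandomPlanarGeometry/SpinObservableLimitPassage.lean`).

Results (all PROVED; no definition, no named fact):

* `isSLELaw_three_of_spinCylinderIdentity` — **CDHKS §3 as one theorem, locally and
  moment-free**: a probability measure `ν` on curve classes carrying a process `W` with strongly
  measurable marginals, continuous paths, `W 0 = 0`, `ν`-a.e. driving the curve through `φ`, whose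
  time-limited spin observables satisfy the cylinder identity, IS the chordal SLE₃ law of
  `(D; a, b)` (monotone class ⟹ natural martingales ⟹ localisation at far-field stopping times ⟹
  far-field expansion: `W/√3` a local martingale with `⟨W/√3⟩_t = t` ⟹ Lévy ⟹ Brownian driving
  process ⟹ SLE₃ trace and its transience; every arrow a theorem of the tree);
* `exists_spinCylinderIdentityData_of_limitData` — **(J′) ∧ (D) ⟹ those data for `(ν, φ)`**, with
  `W c = drivingFunction φ c` (set to `0` on the null set of curves not starting at `a`);
* `isSLELaw_three_of_limitData` — **(J′) ∧ (D) ⟹ `IsSLELaw 3 D ν`**;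
* `isSLELaw_three_of_subseqLimit_spinInterface_of_limitData`,
  `convergesInLawToSLE_three_isingInterface_zd_of_traversalBound_of_limitData` — the global forms:
  if for every instance of F2's hypotheses there is a chordal uniformizing map with (J′) ∧ (D)
  (a.e. describability, driver convergence, discrete martingale data — the clause "curves from
  `a`" being automatic for limits of interface laws, `ae_source_eq_of_tendsto_spinInterfaceLaw`),
  then F2 holds, and with the traversal bound (C1) `spinInterface_traversalBound` so does the
  corrected CDHKS Theorem 1 `convergesInLawToSLE_three_isingInterface_zd`;
* `isSLELaw_three_of_subseqLimit_spinInterface_of_drivingFunction_cylinderIdentity'` — the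
  canonical form of `InterfaceSLELocal.lean` without its "curves from `a`" clause.

So the named-fact-free frontier of F2 is exactly the pair (J′), (D) above, as theorem
hypotheses; (M) `exists_drivingMartingales_of_subseqLimit_spinInterface` is bypassed.

## References

* D. Chelkak, H. Duminil-Copin, C. Hongler, A. Kemppainen, S. Smirnov, *Convergence of Ising
  interfaces to Schramm's SLE curves*, C. R. Math. Acad. Sci. Paris 352 (2014) 157–161
  (arXiv:1312.0533): Thm. 1, Thm. 3, Thm. 4, Rem. 4, §3.
* D. Chelkak, S. Smirnov, *Universality in the 2D Ising model and conformal invariance of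
  fermionic observables*, Invent. Math. 189 (2012) 515–580 (arXiv:0910.2045): Thm. 1.2, Rem. 2.4,
  Thm. 5.6.
* A. Kemppainen, S. Smirnov, *Random curves, scaling limits and Loewner evolutions*, Ann.
  Probab. 45 (2017) 698–779 (arXiv:1212.6215): Thm. 1.5, Cor. 1.7.
-/

noncomputable section

open MeasureTheory ProbabilityTheory Filter Topology Set
open UpperHalfPlane (upperHalfPlaneSet)
open scoped NNReal ENNReal BoundedContinuousFunction
open Literature.Probability.RandomPlanarGeometry Literature.Probability.LatticeModels
  Literature.Probability.Percolation Literature.Probability.Process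

namespace Literature.Probability.LatticeModels

open RandomPlanarGeometry.Loewner
open scoped Literature.Probability.RandomPlanarGeometry.PathBorel

/-! ### CDHKS §3 as one theorem: the cylinder identity identifies SLE₃ (moment-free) -/

/-- **The spin observable's martingale identity identifies chordal SLE₃ (local, moment-free form
of CDHKS §3).** Let `φ` be a chordal uniformizing map of the Dobrushin domain `(D; a, b)`, `ν` a
probability measure on curve classes and `W : CurveClass ℂ → ([0, ∞) → ℝ)` a process with
strongly measurable marginals, continuous paths and `W 0 = 0`, `ν`-a.e. driving the curve through
`φ` (`Loewner.IsDrivenBy`), such that for every `y > 0` the time-limited spin observable process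
`N^y = spinObservableProcess W y` satisfies `E_ν[(N^y_t - N^y_s) ψ(W_S)] = 0` for all `s ≤ t`, all
finite families of times `S ≤ s` and all continuous `|ψ| ≤ 1`. Then `ν` is the chordal SLE₃ law
of `(D; a, b)`. Chain (all proved in the tree): cylinder identity ⟹ `W/√3` is a continuous local
martingale with quadratic variation `t` in the natural filtration of `W`
(`Loewner.isLocalMartingale_hasQuadraticVariation_of_spinCylinderIdentity`: monotone class,
localisation at the far-field stopping times of fixed levels, far-field expansion (5)) ⟹ SLE₃
law (`isSLELaw_of_isLocalMartingale_driving_of_lt_four`: Lévy's characterisation, the SLE₃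
trace from the Brownian driving process, transience for `κ < 4`). No moment hypothesis on `W`.
[cite: CDHKSCRAS2014, §3 (proof of Thm. 1)] -/
theorem isSLELaw_three_of_spinCylinderIdentity {D : DobrushinDomain}
    {φ : ConformalEquiv upperHalfPlaneSet D.carrier} (hφ : D.IsChordalUniformizing φ)
    {ν : Measure (CurveClass ℂ)} [IsProbabilityMeasure ν] {W : CurveClass ℂ → ℝ≥0 → ℝ}
    (hW : ∀ t, StronglyMeasurable (fun c ↦ W c t)) (hWc : ∀ c, Continuous (W c))
    (hW0 : ∀ c, W c 0 = 0)
    (hdrv : ∀ᵐ c ∂ν, Loewner.IsDrivenBy φ.boundaryExtension (D.pt 1) (W c) c)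
    (hcyl : ∀ y : ℝ, 0 < y → ∀ s t : ℝ≥0, s ≤ t → ∀ (n : ℕ) (S : Fin n → ℝ≥0), (∀ k, S k ≤ s) →
      ∀ ψ : (Fin n → ℝ) → ℝ, Continuous ψ → (∀ v, |ψ v| ≤ 1) →
        ∫ c, (spinObservableProcess (fun t c ↦ W c t) y t c -
            spinObservableProcess (fun t c ↦ W c t) y s c) * (ψ (fun k ↦ W c (S k)) : ℂ) ∂ν = 0) :
    IsSLELaw 3 D ν := by
  obtain ⟨hloc, hQ⟩ :=
    isLocalMartingale_hasQuadraticVariation_of_spinCylinderIdentity (W := fun t c ↦ W c t) (P := ν)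
      hW hWc hW0 hcyl
  have hsq : Real.sqrt ((3 : ℝ≥0) : ℝ) = Real.sqrt 3 := by norm_num
  refine isSLELaw_of_isLocalMartingale_driving_of_lt_four zero_lt_three (by norm_num) hφ
    (fun t ↦ (hW t).measurable) (ae_of_all _ hW0) (ae_of_all _ hWc)
    (𝓕 := Filtration.natural (fun t c ↦ W c t) hW) ?_ ?_ hdrv
  · simpa only [hsq] using hloc
  · simpa only [hsq] using hQ

/-! ### (J′) ∧ (D) ⟹ the cylinder-identity data, for one limit law and one uniformizing map -/

section LimitData

variable {D : DobrushinDomain} {φ : ConformalEquiv upperHalfPlaneSet D.carrier}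
  {ν : Measure (CurveClass ℂ)} [IsProbabilityMeasure ν]
  {Ω' : ℕ → Type*} {mΩ' : ∀ k, MeasurableSpace (Ω' k)} {P : ∀ k, Measure (Ω' k)}
  [∀ k, IsProbabilityMeasure (P k)] {V : ∀ k, ℝ≥0 → Ω' k → ℝ}

/-- **The moment-free cylinder-identity data for one subsequential limit, from the
Kemppainen–Smirnov data (J′) and the discrete observable martingales (D).** Inputs, for a chordal
uniformizing map `φ` of `(D; a, b)` and a probability measure `ν` on curve classes: (J′) `ν`-a.e.
curve class is describable by the Loewner evolution through `φ` (Kemppainen–Smirnov 2017,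
Thm. 1.5; CDHKS Thm. 3 with Thm. 4 / Rem. 4) and starts at `a`; the continuous-path processes
`V^k` (the capacity driving processes of the discrete interfaces along a subsequence of meshes, on
their own probability spaces) converge in distribution in `C([0, ∞), ℝ)` to the driving function
of the limit (KS Cor. 1.7: "the limits agree in the sense that `γ = lim γₙ` is driven by
`W = lim Wₙ`"); and (D) the discrete observable martingale data of
`Loewner.integral_spinObservableProcess_cylinder_eq_zero_of_discreteMartingales` for every `y > 0`
(Chelkak–Smirnov 2012, Rem. 2.4, Thms 1.2 and 5.6). Output: a process `W` on `(CurveClass ℂ, ν)`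
with strongly measurable marginals, continuous paths, `W 0 = 0`, `ν`-a.e. driving the curve, and
the cylinder identity — namely `W c = drivingFunction φ c` for curves from `a` and `0` otherwise.
No tail / moment input. PROVED (`measurable_drivingFunction`, `drivingFunction_apply_zero`, the
passage theorem). [cite: CDHKSCRAS2014, Thm. 3 and §3]
[cite: KemppainenSmirnov2017, Thm. 1.5 and Cor. 1.7] -/
theorem exists_spinCylinderIdentityData_of_limitData (hφ : D.IsChordalUniformizing φ)
    (hdesc : ∀ᵐ c ∂ν, IsLoewnerDescribable φ c) (hsrc : ∀ᵐ c ∂ν, c.source = D.pt 0)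
    (hVc : ∀ k ω, Continuous (V k · ω))
    (hlaw : TendstoInDistribution (fun k ω ↦ (⟨fun u ↦ V k u ω, hVc k ω⟩ : C(ℝ≥0, ℝ))) atTop
      (fun c ↦ (⟨drivingFunction φ c, continuous_drivingFunction φ c⟩ : C(ℝ≥0, ℝ))) P ν)
    (hD : ∀ y : ℝ, 0 < y → ∀ s t : ℝ≥0, s < t → t < cdhksTime y →
      ∃ (C' : ℝ) (ε Δ η : ℕ → ℝ≥0), Tendsto ε atTop (𝓝 0) ∧ Tendsto Δ atTop (𝓝 0) ∧
        Tendsto η atTop (𝓝 0) ∧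
        ∀ k, ∃ (𝒢 : Filtration ℕ (mΩ' k)) (F : ℕ → Ω' k → ℂ) (σ τ : Ω' k → WithTop ℕ)
          (hσ : IsStoppingTime 𝒢 σ) (M : ℕ) (bad : Set (Ω' k)),
          IsStoppingTime 𝒢 τ ∧ Martingale F 𝒢 (P k) ∧ σ ≤ τ ∧ (∀ ω, τ ω ≤ M) ∧
          (∀ u, u ≤ s → Measurable[hσ.measurableSpace] (V k u)) ∧
          (∀ᵐ ω ∂P k, ‖stoppedValue F σ ω‖ ≤ C') ∧ (∀ᵐ ω ∂P k, ‖stoppedValue F τ ω‖ ≤ C') ∧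
          MeasurableSet bad ∧ P k bad ≤ η k ∧
          ∀ᵐ ω ∂P k, ω ∉ bad →
            (∃ u ∈ Icc s (s + Δ k), ‖stoppedValue F σ ω - spinObservableProcess (V k) y u ω‖ ≤ ε k) ∧
            (∃ u ∈ Icc t (t + Δ k), ‖stoppedValue F τ ω - spinObservableProcess (V k) y u ω‖ ≤ ε k)) :
    ∃ W : CurveClass ℂ → ℝ≥0 → ℝ,
      (∀ t, StronglyMeasurable (fun c ↦ W c t)) ∧ (∀ c, Continuous (W c)) ∧ (∀ c, W c 0 = 0) ∧
      (∀ᵐ c ∂ν, Loewner.IsDrivenBy φ.boundaryExtension (D.pt 1) (W c) c) ∧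
      ∀ y : ℝ, 0 < y → ∀ s t : ℝ≥0, s ≤ t → ∀ (n : ℕ) (S : Fin n → ℝ≥0), (∀ k, S k ≤ s) →
        ∀ ψ : (Fin n → ℝ) → ℝ, Continuous ψ → (∀ v, |ψ v| ≤ 1) →
          ∫ c, (spinObservableProcess (fun t c ↦ W c t) y t c -
              spinObservableProcess (fun t c ↦ W c t) y s c) * (ψ (fun k ↦ W c (S k)) : ℂ) ∂ν = 0 := by
  classical
  -- the driving function, zeroed on the (null) set of curves not starting at `a`
  set W : CurveClass ℂ → ℝ≥0 → ℝ :=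
    fun c t ↦ if c.source = D.pt 0 then drivingFunction φ c t else 0 with hWdef
  have hWeq : ∀ {c : CurveClass ℂ}, c.source = D.pt 0 → W c = drivingFunction φ c := by
    intro c hc
    funext t
    simp [hWdef, hc]
  have hWae : ∀ᵐ c ∂ν, W c = drivingFunction φ c := by
    filter_upwards [hsrc] with c hc
    exact hWeq hc
  have hWm : ∀ t, StronglyMeasurable (fun c ↦ W c t) := fun t ↦
    (Measurable.ite (CurveClass.isClosed_setOf_source_eq (D.pt 0)).measurableSet
      (measurable_drivingFunction_apply hφ t) measurable_const).stronglyMeasurable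
  have hWc : ∀ c, Continuous (W c) := by
    intro c
    by_cases hc : c.source = D.pt 0
    · rw [hWeq hc]
      exact continuous_drivingFunction φ c
    · have : W c = 0 := by
        funext t
        simp [hWdef, hc]
      rw [this]
      exact continuous_const
  have hW0 : ∀ c, W c 0 = 0 := by
    intro c
    by_cases hc : c.source = D.pt 0
    · rw [hWeq hc]
      exact drivingFunction_apply_zero hφ hc
    · simp [hWdef, hc]
  -- convergence in distribution to the paths of `W`
  have hlaw' : TendstoInDistribution (fun k ω ↦ (⟨fun u ↦ V k u ω, hVc k ω⟩ : C(ℝ≥0, ℝ))) atTop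
      (fun c ↦ (⟨fun u ↦ W c u, hWc c⟩ : C(ℝ≥0, ℝ))) P ν := by
    refine hlaw.congr (fun k ↦ EventuallyEq.rfl) ?_
    filter_upwards [hWae] with c hc
    ext u
    simp [hc]
  refine ⟨W, hWm, hWc, hW0, ?_, fun y hy ↦ ?_⟩
  · -- a.e. the curve is driven by `W c`
    filter_upwards [hdesc, hsrc] with c hd hs
    rw [hWeq hs]
    exact (isLoewnerDescribed_drivingFunction hd).2
  · -- the cylinder identity, by the passage theorem
    exact integral_spinObservableProcess_cylinder_eq_zero_of_discreteMartingales (W := fun t c ↦ W c t)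
      (fun c ↦ hWc c) hVc hlaw' hy (hD y hy)

/-- **(J′) ∧ (D) ⟹ the subsequential limit is chordal SLE₃** (for one limit law `ν` and one
chordal uniformizing map `φ`): `exists_spinCylinderIdentityData_of_limitData` followed by
`isSLELaw_three_of_spinCylinderIdentity`. This is CDHKS's proof of Thm. 1, §3, with exactly its
two quoted inputs as hypotheses and without the exponential-moment statement of Thm. 3.
[cite: CDHKSCRAS2014, Thm. 1 (proof, §3)] -/
theorem isSLELaw_three_of_limitData (hφ : D.IsChordalUniformizing φ)
    (hdesc : ∀ᵐ c ∂ν, IsLoewnerDescribable φ c) (hsrc : ∀ᵐ c ∂ν, c.source = D.pt 0)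
    (hVc : ∀ k ω, Continuous (V k · ω))
    (hlaw : TendstoInDistribution (fun k ω ↦ (⟨fun u ↦ V k u ω, hVc k ω⟩ : C(ℝ≥0, ℝ))) atTop
      (fun c ↦ (⟨drivingFunction φ c, continuous_drivingFunction φ c⟩ : C(ℝ≥0, ℝ))) P ν)
    (hD : ∀ y : ℝ, 0 < y → ∀ s t : ℝ≥0, s < t → t < cdhksTime y →
      ∃ (C' : ℝ) (ε Δ η : ℕ → ℝ≥0), Tendsto ε atTop (𝓝 0) ∧ Tendsto Δ atTop (𝓝 0) ∧
        Tendsto η atTop (𝓝 0) ∧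
        ∀ k, ∃ (𝒢 : Filtration ℕ (mΩ' k)) (F : ℕ → Ω' k → ℂ) (σ τ : Ω' k → WithTop ℕ)
          (hσ : IsStoppingTime 𝒢 σ) (M : ℕ) (bad : Set (Ω' k)),
          IsStoppingTime 𝒢 τ ∧ Martingale F 𝒢 (P k) ∧ σ ≤ τ ∧ (∀ ω, τ ω ≤ M) ∧
          (∀ u, u ≤ s → Measurable[hσ.measurableSpace] (V k u)) ∧
          (∀ᵐ ω ∂P k, ‖stoppedValue F σ ω‖ ≤ C') ∧ (∀ᵐ ω ∂P k, ‖stoppedValue F τ ω‖ ≤ C') ∧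
          MeasurableSet bad ∧ P k bad ≤ η k ∧
          ∀ᵐ ω ∂P k, ω ∉ bad →
            (∃ u ∈ Icc s (s + Δ k), ‖stoppedValue F σ ω - spinObservableProcess (V k) y u ω‖ ≤ ε k) ∧
            (∃ u ∈ Icc t (t + Δ k), ‖stoppedValue F τ ω - spinObservableProcess (V k) y u ω‖ ≤ ε k)) :
    IsSLELaw 3 D ν := by
  obtain ⟨W, hW, hWc, hW0, hdrv, hcyl⟩ :=
    exists_spinCylinderIdentityData_of_limitData hφ hdesc hsrc hVc hlaw hD
  exact isSLELaw_three_of_spinCylinderIdentity hφ hW hWc hW0 hdrv hcyl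

end LimitData

/-! ### Global forms: (J′) ∧ (D) for every limit ⟹ F2 and the corrected CDHKS Theorem 1 -/

/-- **F2 from the limit data (J′) ∧ (D).** If for every Dobrushin domain `(D; a, b)`, admissible
discretisations `E`, interface-selection rules `sel`, meshes `u n → 0⁺` and every probability
measure `ν` on the curve space to which the critical spin-Ising interface laws
`spinInterfaceLaw D E sel (u n)` converge weakly, there is a chordal uniformizing map `φ` with the
Kemppainen–Smirnov conclusion for `ν` (a.e. describable through `φ`), discrete
driving processes `V^k` on probability spaces `(Ω' k, P k)` converging in distribution to the
driving function of `ν` (J′), and the discrete spin-observable martingale data (D), then every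
such `ν` is the chordal SLE₃ law of `(D; a, b)`: the named fact F2
`isSLELaw_three_of_subseqLimit_spinInterface` holds (`isSLELaw_three_of_limitData`; the clause
"`ν`-a.e. curve from `a`" is supplied by `ae_source_eq_of_tendsto_spinInterfaceLaw`,
`InterfaceSLESource.lean`). PROVED.
[cite: CDHKSCRAS2014, Thm. 1 (proof, §3)] -/
theorem isSLELaw_three_of_subseqLimit_spinInterface_of_limitData
    (h : ∀ (D : DobrushinDomain) (E : ℝ → DiscreteDobrushin) (_hE : IsDiscretisation D E)
      (sel : ℝ → SpinConfig (Site 2) → List (Sym2 (Site 2)))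
      (_hsel : ∀ δ, IsInterfaceSelection (E δ) (sel δ))
      (u : ℕ → ℝ) (_hu : Tendsto u atTop (𝓝[>] 0))
      (ν : Measure (CurveClass ℂ)) [IsProbabilityMeasure ν],
      (∀ f : CurveClass ℂ →ᵇ ℝ,
        Tendsto (fun n => ∫ c, f c ∂spinInterfaceLaw D E sel (u n)) atTop (𝓝 (∫ c, f c ∂ν))) →
      ∃ φ : ConformalEquiv upperHalfPlaneSet D.carrier, D.IsChordalUniformizing φ ∧
        (∀ᵐ c ∂ν, IsLoewnerDescribable φ c) ∧
        ∃ (Ω' : ℕ → Type) (mΩ' : ∀ k, MeasurableSpace (Ω' k)) (P : ∀ k, Measure (Ω' k))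
          (_ : ∀ k, IsProbabilityMeasure (P k)) (V : ∀ k, ℝ≥0 → Ω' k → ℝ)
          (hVc : ∀ k ω, Continuous (V k · ω)),
          TendstoInDistribution (fun k ω ↦ (⟨fun u ↦ V k u ω, hVc k ω⟩ : C(ℝ≥0, ℝ))) atTop
            (fun c ↦ (⟨drivingFunction φ c, continuous_drivingFunction φ c⟩ : C(ℝ≥0, ℝ))) P ν ∧
          (∀ y : ℝ, 0 < y → ∀ s t : ℝ≥0, s < t → t < cdhksTime y →
            ∃ (C' : ℝ) (ε Δ η : ℕ → ℝ≥0), Tendsto ε atTop (𝓝 0) ∧ Tendsto Δ atTop (𝓝 0) ∧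
              Tendsto η atTop (𝓝 0) ∧
              ∀ k, ∃ (𝒢 : Filtration ℕ (mΩ' k)) (F : ℕ → Ω' k → ℂ) (σ τ : Ω' k → WithTop ℕ)
                (hσ : IsStoppingTime 𝒢 σ) (M : ℕ) (bad : Set (Ω' k)),
                IsStoppingTime 𝒢 τ ∧ Martingale F 𝒢 (P k) ∧ σ ≤ τ ∧ (∀ ω, τ ω ≤ M) ∧
                (∀ u, u ≤ s → Measurable[hσ.measurableSpace] (V k u)) ∧
                (∀ᵐ ω ∂P k, ‖stoppedValue F σ ω‖ ≤ C') ∧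
                (∀ᵐ ω ∂P k, ‖stoppedValue F τ ω‖ ≤ C') ∧
                MeasurableSet bad ∧ P k bad ≤ η k ∧
                ∀ᵐ ω ∂P k, ω ∉ bad →
                  (∃ u ∈ Icc s (s + Δ k),
                    ‖stoppedValue F σ ω - spinObservableProcess (V k) y u ω‖ ≤ ε k) ∧
                  (∃ u ∈ Icc t (t + Δ k),
                    ‖stoppedValue F τ ω - spinObservableProcess (V k) y u ω‖ ≤ ε k))) :
    isSLELaw_three_of_subseqLimit_spinInterface := by
  intro D E hE sel hsel u hu ν hν hlim
  obtain ⟨φ, hφ, hdesc, Ω', mΩ', P, hP, V, hVc, hlaw, hD⟩ := h D E hE sel hsel u hu ν hlim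
  exact isSLELaw_three_of_limitData hφ hdesc (ae_source_eq_of_tendsto_spinInterfaceLaw hE hsel hu hlim)
    hVc hlaw hD

/-- **CDHKS Theorem 1 (corrected transcription) from (C1) and the limit data (J′) ∧ (D).**
Convergence in law of the critical spin-Ising Dobrushin interfaces to chordal SLE₃,
`convergesInLawToSLE_three_isingInterface_zd`, follows from the traversal bound (C1)
`spinInterface_traversalBound` (CDHKS §2) and the limit data (J′) ∧ (D) for every subsequential
limit (hypothesis of `isSLELaw_three_of_subseqLimit_spinInterface_of_limitData`); tightness,
Prokhorov, uniqueness in law of chordal SLE, localisation, Lévy, the SLE₃ trace and its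
transience, and the passage discrete martingales ⟹ cylinder identity are theorems of the tree.
PROVED. [cite: CDHKSCRAS2014, Thm. 1, §§2–3] -/
theorem convergesInLawToSLE_three_isingInterface_zd_of_traversalBound_of_limitData
    (h1 : spinInterface_traversalBound)
    (h : ∀ (D : DobrushinDomain) (E : ℝ → DiscreteDobrushin) (_hE : IsDiscretisation D E)
      (sel : ℝ → SpinConfig (Site 2) → List (Sym2 (Site 2)))
      (_hsel : ∀ δ, IsInterfaceSelection (E δ) (sel δ))
      (u : ℕ → ℝ) (_hu : Tendsto u atTop (𝓝[>] 0))
      (ν : Measure (CurveClass ℂ)) [IsProbabilityMeasure ν],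
      (∀ f : CurveClass ℂ →ᵇ ℝ,
        Tendsto (fun n => ∫ c, f c ∂spinInterfaceLaw D E sel (u n)) atTop (𝓝 (∫ c, f c ∂ν))) →
      ∃ φ : ConformalEquiv upperHalfPlaneSet D.carrier, D.IsChordalUniformizing φ ∧
        (∀ᵐ c ∂ν, IsLoewnerDescribable φ c) ∧
        ∃ (Ω' : ℕ → Type) (mΩ' : ∀ k, MeasurableSpace (Ω' k)) (P : ∀ k, Measure (Ω' k))
          (_ : ∀ k, IsProbabilityMeasure (P k)) (V : ∀ k, ℝ≥0 → Ω' k → ℝ)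
          (hVc : ∀ k ω, Continuous (V k · ω)),
          TendstoInDistribution (fun k ω ↦ (⟨fun u ↦ V k u ω, hVc k ω⟩ : C(ℝ≥0, ℝ))) atTop
            (fun c ↦ (⟨drivingFunction φ c, continuous_drivingFunction φ c⟩ : C(ℝ≥0, ℝ))) P ν ∧
          (∀ y : ℝ, 0 < y → ∀ s t : ℝ≥0, s < t → t < cdhksTime y →
            ∃ (C' : ℝ) (ε Δ η : ℕ → ℝ≥0), Tendsto ε atTop (𝓝 0) ∧ Tendsto Δ atTop (𝓝 0) ∧
              Tendsto η atTop (𝓝 0) ∧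
              ∀ k, ∃ (𝒢 : Filtration ℕ (mΩ' k)) (F : ℕ → Ω' k → ℂ) (σ τ : Ω' k → WithTop ℕ)
                (hσ : IsStoppingTime 𝒢 σ) (M : ℕ) (bad : Set (Ω' k)),
                IsStoppingTime 𝒢 τ ∧ Martingale F 𝒢 (P k) ∧ σ ≤ τ ∧ (∀ ω, τ ω ≤ M) ∧
                (∀ u, u ≤ s → Measurable[hσ.measurableSpace] (V k u)) ∧
                (∀ᵐ ω ∂P k, ‖stoppedValue F σ ω‖ ≤ C') ∧
                (∀ᵐ ω ∂P k, ‖stoppedValue F τ ω‖ ≤ C') ∧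
                MeasurableSet bad ∧ P k bad ≤ η k ∧
                ∀ᵐ ω ∂P k, ω ∉ bad →
                  (∃ u ∈ Icc s (s + Δ k),
                    ‖stoppedValue F σ ω - spinObservableProcess (V k) y u ω‖ ≤ ε k) ∧
                  (∃ u ∈ Icc t (t + Δ k),
                    ‖stoppedValue F τ ω - spinObservableProcess (V k) y u ω‖ ≤ ε k))) :
    convergesInLawToSLE_three_isingInterface_zd :=
  convergesInLawToSLE_three_isingInterface_zd_of_traversalBound' h1
    (isSLELaw_three_of_subseqLimit_spinInterface_of_limitData h)

/-- **F2 from describability and the cylinder identity for the Loewner transform (no support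
clause).** As `isSLELaw_three_of_subseqLimit_spinInterface_of_drivingFunction_cylinderIdentity`
(`InterfaceSLELocal.lean`), with the hypothesis "`ν`-a.e. curve class starts at `a`" removed: it
holds automatically for weak subsequential limits of the interface laws
(`ae_source_eq_of_tendsto_spinInterfaceLaw`). So F2 follows from: for every instance, a chordal
uniformizing map `φ` with `ν`-a.e. `IsLoewnerDescribable φ c` (Kemppainen–Smirnov 2017,
Thm. 1.5 (ii)) and the cylinder identity of the time-limited spin observables of
`drivingFunction φ` under `ν` (CDHKS §3 before its last paragraph). PROVED.
[cite: CDHKSCRAS2014, Thm. 3 and §3 (proof of Thm. 1)]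
[cite: KemppainenSmirnov2017, Thm. 1.5 and Cor. 1.7] -/
theorem isSLELaw_three_of_subseqLimit_spinInterface_of_drivingFunction_cylinderIdentity'
    (h : ∀ (D : DobrushinDomain) (E : ℝ → DiscreteDobrushin) (_hE : IsDiscretisation D E)
      (sel : ℝ → SpinConfig (Site 2) → List (Sym2 (Site 2)))
      (_hsel : ∀ δ, IsInterfaceSelection (E δ) (sel δ))
      (u : ℕ → ℝ) (_hu : Tendsto u atTop (𝓝[>] 0))
      (ν : Measure (CurveClass ℂ)) [IsProbabilityMeasure ν],
      (∀ f : CurveClass ℂ →ᵇ ℝ,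
        Tendsto (fun n => ∫ c, f c ∂spinInterfaceLaw D E sel (u n)) atTop (𝓝 (∫ c, f c ∂ν))) →
      ∃ φ : ConformalEquiv upperHalfPlaneSet D.carrier,
        D.IsChordalUniformizing φ ∧
        (∀ᵐ c ∂ν, IsLoewnerDescribable φ c) ∧
        ∀ y : ℝ, 0 < y → ∀ s t : ℝ≥0, s ≤ t → ∀ (n : ℕ) (S : Fin n → ℝ≥0), (∀ k, S k ≤ s) →
          ∀ ψ : (Fin n → ℝ) → ℝ, Continuous ψ → (∀ v, |ψ v| ≤ 1) →
            ∫ c, (spinObservableProcess (fun t c ↦ drivingFunction φ c t) y t c -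
                spinObservableProcess (fun t c ↦ drivingFunction φ c t) y s c) *
              (ψ (fun k ↦ drivingFunction φ c (S k)) : ℂ) ∂ν = 0) :
    isSLELaw_three_of_subseqLimit_spinInterface := by
  refine isSLELaw_three_of_subseqLimit_spinInterface_of_drivingFunction_cylinderIdentity
    fun D E hE sel hsel u hu ν hν hlim ↦ ?_
  obtain ⟨φ, hφ, hdesc, hcyl⟩ := h D E hE sel hsel u hu ν hlim
  exact ⟨φ, hφ, hdesc, ae_source_eq_of_tendsto_spinInterfaceLaw hE hsel hu hlim, hcyl⟩

end Literature.Probability.LatticeModels
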